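import Mathlib
import Summits.PneNP.PneNP.Theses.AeaCutRectangles

/-!
# IdeasR2s2g8 — first lemmas for the crux-ideate cards `three-phase-vortex-calculus` and
`certain-forcing-juntas` (crux X1 = `AeaCutRectangles.FoolingMeasure`, stmt-PneNP-19727).

Frame language: a reference labelling `r : V → ZMod 3`, arcs `u → v` with `r v = r u + 1`,
sites = edges with `r u = r v`.  A 3-colouring is written `c = r + q` with a *phase* `q : V → ZMod 3`.
* `arc_proper_iff` / `site_proper_iff`: the frame re-encoding (properness ⟺ phase steps ∈ {0,1} on arcs,
  phases differ on sites).
* `phase_steps`: SOUNDNESS of the three-phase (leak-set) criterion — bulk / `P` / `Z` with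
  (C1) out(P) ⊆ P ∪ Z, (C2) in(Z) ⊆ P ∪ Z, (C3) no arc Z → P gives admissible phase steps on every arc.
* `potential_eq_of_biReachable`: zero-winding rigidity — an arc-monotone ℕ-potential is constant on
  mutually reachable vertices, so no zero-winding colouring separates an intra-SCC site.
* `biReachable_mono`: certainty of forcing is monotone in the arc set (the junta/closure trick).
-/

set_option linter.dupNamespace false

namespace Summit.PneNP.PneNP.Cruxes.FoolingMeasure.IdeasR2s2g8

open Relation

variable {V : Type*}

/-- properness of `c = r + q` across an arc `u → v` (`r v = r u + 1`) ⟺ the phase does not step by `2`. -/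
theorem arc_proper_iff (r q : V → ZMod 3) {u v : V} (h : r v = r u + 1) :
    r u + q u ≠ r v + q v ↔ q v - q u ≠ 2 := by
  rw [h]
  have key : ∀ a b c : ZMod 3, (c + a = c + 1 + b ↔ b - a = 2) := by decide
  exact not_congr (key (q u) (q v) (r u))

/-- properness across a site (`r u = r v`) ⟺ the phases differ. -/
theorem site_proper_iff (r q : V → ZMod 3) {u v : V} (h : r u = r v) :
    r u + q u ≠ r v + q v ↔ q u ≠ q v := by
  rw [h]
  have key : ∀ a b c : ZMod 3, (c + a = c + b ↔ a = b) := by decide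
  exact not_congr (key (q u) (q v) (r v))

open Classical in
/-- the phase function of a three-phase pattern: `2` on the leak set `Z`, `1` on `P`, `0` on the bulk. -/
noncomputable def phase (P Z : Set V) (v : V) : ZMod 3 :=
  if v ∈ Z then 2 else if v ∈ P then 1 else 0

open Classical in
theorem phase_of_mem_Z {P Z : Set V} {v : V} (h : v ∈ Z) : phase P Z v = 2 := by simp [phase, h]

open Classical in
theorem phase_of_mem_P {P Z : Set V} {v : V} (hP : v ∈ P) (hZ : v ∉ Z) : phase P Z v = 1 := by
  simp [phase, hP, hZ]

open Classical in
theorem phase_of_bulk {P Z : Set V} {v : V} (hP : v ∉ P) (hZ : v ∉ Z) : phase P Z v = 0 := by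
  simp [phase, hP, hZ]

/-- SOUNDNESS of the leak-set criterion: (C1) out(P ∖ Z) ⊆ P ∪ Z, (C2) in(Z) ⊆ P ∪ Z, (C3) no arc Z → P ∖ Z
imply that the phase never steps by `2` along an arc. -/
theorem phase_steps (arc : V → V → Prop) (P Z : Set V)
    (hC1 : ∀ u v, arc u v → u ∈ P → u ∉ Z → v ∈ P ∨ v ∈ Z)
    (hC2 : ∀ u v, arc u v → v ∈ Z → u ∈ P ∨ u ∈ Z)
    (hC3 : ∀ u v, arc u v → u ∈ Z → v ∈ P → v ∈ Z) :
    ∀ u v, arc u v → phase P Z v - phase P Z u ≠ 2 := by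
  intro u v huv
  by_cases huZ : u ∈ Z
  · by_cases hvZ : v ∈ Z
    · rw [phase_of_mem_Z huZ, phase_of_mem_Z hvZ]; decide
    · have hvP : v ∉ P := fun hvP => hvZ (hC3 u v huv huZ hvP)
      rw [phase_of_mem_Z huZ, phase_of_bulk hvP hvZ]; decide
  · by_cases huP : u ∈ P
    · rcases hC1 u v huv huP huZ with hvP | hvZ
      · by_cases hvZ : v ∈ Z
        · rw [phase_of_mem_P huP huZ, phase_of_mem_Z hvZ]; decide
        · rw [phase_of_mem_P huP huZ, phase_of_mem_P hvP hvZ]; decide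
      · rw [phase_of_mem_P huP huZ, phase_of_mem_Z hvZ]; decide
    · have hvZ : v ∉ Z := by
        intro hvZ
        rcases hC2 u v huv hvZ with h | h
        · exact huP h
        · exact huZ h
      by_cases hvP : v ∈ P
      · rw [phase_of_bulk huP huZ, phase_of_mem_P hvP hvZ]; decide
      · rw [phase_of_bulk huP huZ, phase_of_bulk hvP hvZ]; decide

/-- mutual reachability along the arcs. -/
def BiReachable (arc : V → V → Prop) (x y : V) : Prop :=
  ReflTransGen arc x y ∧ ReflTransGen arc y x

/-- ZERO-WINDING RIGIDITY: an arc-monotone ℕ-potential is constant on mutually reachable vertices.  Hence a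
zero-winding colouring (`q = D mod 3`, `D` arc-monotone with steps ≤ 1) cannot separate an intra-SCC site. -/
theorem potential_eq_of_biReachable (arc : V → V → Prop) (D : V → ℕ)
    (hmono : ∀ u v, arc u v → D u ≤ D v) {x y : V} (h : BiReachable arc x y) : D x = D y := by
  have key : ∀ a b, ReflTransGen arc a b → D a ≤ D b := by
    intro a b hab
    induction hab with
    | refl => exact le_rfl
    | tail _ hbc ih => exact le_trans ih (hmono _ _ hbc)
  exact le_antisymm (key x y h.1) (key y x h.2)

/-- CERTAINTY IS MONOTONE: if the site endpoints are mutually reachable using a sub-family of arcs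
(frozen row edges ∪ the column's arcs), they are mutually reachable in every hybrid containing those arcs. -/
theorem biReachable_mono {arc arc' : V → V → Prop} (hsub : ∀ u v, arc u v → arc' u v) {x y : V}
    (h : BiReachable arc x y) : BiReachable arc' x y := by
  have key : ∀ a b, ReflTransGen arc a b → ReflTransGen arc' a b := by
    intro a b hab
    induction hab with
    | refl => exact ReflTransGen.refl
    | tail _ hbc ih => exact ih.tail (hsub _ _ hbc)
  exact ⟨key x y h.1, key y x h.2⟩

/-- FORCED: a zero-winding colouring with phase `q v = (D v : ZMod 3)` for an arc-monotone potential `D`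
gives equal colours at a bi-reachable site, i.e. it is never proper there. -/
theorem zeroWinding_not_proper_at_site (arc : V → V → Prop) (r : V → ZMod 3) (D : V → ℕ)
    (hmono : ∀ u v, arc u v → D u ≤ D v) {x y : V} (hsite : r x = r y) (h : BiReachable arc x y) :
    r x + (D x : ZMod 3) = r y + (D y : ZMod 3) := by
  rw [hsite, potential_eq_of_biReachable arc D hmono h]


/-- THE JUNTA RECTANGLE IS FORCED (composition of the two lemmas above): if the site endpoints are mutually reachable using only
the frozen row arcs `arcF` and the column's arcs `arcC`, then in ANY hybrid whose arc set `arcH` contains both, every zero-winding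
colouring `r + D` (`D` an arc-monotone ℕ-potential on `arcH`) gives equal colours at the site `{x, y}` — whatever the row does off
the frozen set. -/
theorem junta_forced {arcF arcC arcH : V → V → Prop} (hF : ∀ u v, arcF u v → arcH u v) (hC : ∀ u v, arcC u v → arcH u v)
    (r : V → ZMod 3) (D : V → ℕ) (hmono : ∀ u v, arcH u v → D u ≤ D v) {x y : V} (hsite : r x = r y)
    (hq : BiReachable (fun u v => arcF u v ∨ arcC u v) x y) :
    r x + (D x : ZMod 3) = r y + (D y : ZMod 3) := by
  have hsub : ∀ u v, (arcF u v ∨ arcC u v) → arcH u v := by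
    intro u v huv
    rcases huv with h | h
    · exact hF u v h
    · exact hC u v h
  exact zeroWinding_not_proper_at_site arcH r D hmono hsite (biReachable_mono hsub hq)

end Summit.PneNP.PneNP.Cruxes.FoolingMeasure.IdeasR2s2g8
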